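import Literature.NumberTheory.DiophantineApproximation.RhinViolaMobiusResidue
import Literature.NumberTheory.DiophantineApproximation.RhinViolaDoubleResidueHL
import HarnessLib

/-!
# `J_z^{(2)}` in the `(ξ, η)` coordinates and Viola–Zudilin Lemma 2.3

Topic `Literature/NumberTheory/DiophantineApproximation`. DEFINITIONS (`etaModel`, `J₂eta`) with proved API;
no named facts.

* `RhinViola.etaModel s n z P = Σ_{i≤n} (−1)^{n−i} binom(s+n−i−1, n−i) · D^{(i)}P · (X−z)^i`, the polynomial with
  `resXZ s (n+1) P x z = etaModel(x)/(x−z)^{s+n}` (`resXZ_eq_etaModel_div`), so that the outer integrand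
  `ξ^j(1−ξ)^h · resXZ(ξ)` is `ξ^j(1−ξ)^h etaModel(ξ)/(ξ−z)^{s+n}` and its residue at `ξ = z` (Cauchy once more)
  is `D^{(s+n−1)}[X^j(1−X)^h etaModel](z)` — by `RhinViola.hasseDeriv_eval_eq_of_eval_div_eq` this is the SAME
  residue as the tree's `I2` (`I2_eq_eta`);
* `ViolaZudilin.J₂eta z h j k l m q := (−1)^{l+N+1} Σ_{i≤n} (−1)^{n−i} binom(d−i, n−i) D^{(d−i)}[X^j(1−X)^h · D^{(i)}(X^k(1−X)^N)](z)`
  (`n = j+k−m`, `N = j+q−m`, `d = k+l+N = n+l+q`) — Viola–Zudilin's (2.12) evaluated by Cauchy's formula in `η`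
  at `η = ξ` and then in `ξ` at `ξ = Z` (a polynomial in `Z` of degree `≤ h+j−l`, cf. VZ after (2.12)), and
  **`J₂_eq_J₂eta`**: `J₂ z h j k l m q = J₂eta z h j k l m q` for real `z ≠ 0` (`m ≤ j+k`, `m ≤ j+q`);
* **Viola–Zudilin Lemma 2.3** (`J₂eta_reflect`): `J₂eta (1−Z) j h (j+q−m) l (h+q−k) q = (−1)^l J₂eta Z h j k l m q`
  for every real `Z` — the substitution `(ξ, η, Z) ↦ (1−ξ, 1−η, 1−Z)` ((2.13)), realised on Hasse derivatives
  by `hasseDeriv_comp_one_sub_X` (`D^{(i)}(P(1−X)) = (−1)^i (D^{(i)}P)(1−X)`).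

## References

* C. Viola, W. Zudilin, J. reine angew. Math. 736 (2018) 193–223, (2.12), (2.13), Lemma 2.3. [ViolaZudilin2018]
* G. Rhin, C. Viola, Ann. Sc. Norm. Super. Pisa Cl. Sci. (5) 4 (2005) 389–437, (2.3). [RhinViola2005]
-/

noncomputable section

namespace Literature.NumberTheory.DiophantineApproximation

open Finset Polynomial

namespace RhinViola

/-! ### The polynomial model of `resXZ` -/

/-- `etaModel s n z P = Σ_{i≤n} (−1)^{n−i} binom(s+n−i−1, n−i) · D^{(i)}P · (X−z)^i`. [cite: ViolaZudilin2018, (2.12)] -/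
def etaModel (s n : ℕ) (z : ℝ) (P : ℝ[X]) : ℝ[X] :=
  ∑ i ∈ range (n + 1), ((-1) ^ (n - i) * ((s + (n - i) - 1).choose (n - i) : ℝ)) • (hasseDeriv i P * (X - C z) ^ i)

/-- `resXZ s (n+1) P x z = etaModel(x)/(x−z)^{s+n}` for `x ≠ z`. [cite: ViolaZudilin2018, (2.12)] -/
theorem resXZ_eq_etaModel_div (s n : ℕ) (P : ℝ[X]) {x z : ℝ} (hxz : x ≠ z) :
    resXZ s (n + 1) P x z = (etaModel s n z P).eval x / (x - z) ^ (s + n) := by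
  have hxz' : x - z ≠ 0 := sub_ne_zero.2 hxz
  rw [resXZ, etaModel, eval_finsetSum, sum_div]
  refine sum_congr rfl fun i hi => ?_
  have hin : i ≤ n := Nat.lt_succ_iff.1 (mem_range.1 hi)
  simp only [eval_smul, eval_mul, eval_pow, eval_sub, eval_X, eval_C, smul_eq_mul]
  rw [show n + 1 - 1 - i = n - i by omega]
  have hz : (x - z) ^ (-((s : ℤ) + ((n - i : ℕ) : ℤ))) = (x - z) ^ i / (x - z) ^ (s + n) := by
    rw [eq_div_iff (pow_ne_zero _ hxz'), ← zpow_natCast, ← zpow_natCast, ← zpow_add₀ hxz', Nat.cast_sub hin]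
    push_cast
    ring_nf
  rw [hz]
  ring

/-- `etaModel` is additive in `P`. [folklore] -/
theorem etaModel_add (s n : ℕ) (z : ℝ) (P₁ P₂ : ℝ[X]) :
    etaModel s n z (P₁ + P₂) = etaModel s n z P₁ + etaModel s n z P₂ := by
  simp only [etaModel, map_add, add_mul, smul_add, sum_add_distrib]

/-- `etaModel` is homogeneous in `P`. [folklore] -/
theorem etaModel_smul (s n : ℕ) (z c : ℝ) (P : ℝ[X]) : etaModel s n z (c • P) = c • etaModel s n z P := by
  simp only [etaModel, map_smul, smul_mul_assoc, smul_comm c, smul_sum]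

/-- `etaModel` of a finite linear combination. [folklore] -/
theorem etaModel_sum {ι : Type*} (t : Finset ι) (s n : ℕ) (z : ℝ) (c : ι → ℝ) (P : ι → ℝ[X]) :
    etaModel s n z (∑ i ∈ t, c i • P i) = ∑ i ∈ t, c i • etaModel s n z (P i) := by
  classical
  induction t using Finset.induction_on with
  | empty => simp [etaModel]
  | insert b t hb ih => rw [sum_insert hb, sum_insert hb, etaModel_add, etaModel_smul, ih]

/-- The residue at `ξ = z` of `F(ξ)·etaModel(ξ)/(ξ−z)^{s+n}`:
`D^{(s+n−1)}[F · etaModel](z) = Σ_i c_i D^{(s+n−1−i)}[F · D^{(i)}P](z)` (`s ≥ 1`). [cite: ViolaZudilin2018, (2.12)] -/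
theorem hasseDeriv_mul_etaModel_eval {s : ℕ} (hs : 1 ≤ s) (n : ℕ) (z : ℝ) (F P : ℝ[X]) :
    (hasseDeriv (s + n - 1) (F * etaModel s n z P)).eval z =
      ∑ i ∈ range (n + 1), ((-1) ^ (n - i) * ((s + (n - i) - 1).choose (n - i) : ℝ)) *
        (hasseDeriv (s + n - 1 - i) (F * hasseDeriv i P)).eval z := by
  rw [etaModel, mul_sum, map_sum, eval_finsetSum]
  refine sum_congr rfl fun i hi => ?_
  have hin : i ≤ n := Nat.lt_succ_iff.1 (mem_range.1 hi)
  rw [mul_smul_comm, LinearMap.map_smul, eval_smul, smul_eq_mul, ← mul_assoc,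
    show s + n - 1 = (s + n - 1 - i) + i by omega, hasseDeriv_mul_X_sub_C_pow_eval,
    show s + n - 1 - i + i - i = s + n - 1 - i by omega]

/-- **`I2` by the `(ξ,η)` residues**: for `z ≠ 0`, `m ≤ j+k`, `k+l ≤ d`, `n = j+k−m ≤ d`,
`I2 z h j k l m = z^{−l−m} · (−z^{−n}) · D^{(d)}[X^j(1−X)^h · etaModel (d+1−n) n z (pullback d z (X^k(1−X)^l))](z)`.
[cite: RhinViola2005, (2.3)] -/
theorem I2_eq_eta {z : ℝ} (hz : z ≠ 0) {j k m : ℕ} (hm : m ≤ j + k) (h l : ℕ) {d : ℕ} (hd : k + l ≤ d)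
    (hnd : j + k - m ≤ d) :
    I2 z h j k l m = z ^ (-((l : ℤ) + m)) * (-(z⁻¹) ^ (j + k - m) *
      (hasseDeriv d ((X : ℝ[X]) ^ j * (1 - X) ^ h *
        etaModel (d + 1 - (j + k - m)) (j + k - m) z (pullback d z (X ^ k * (1 - X) ^ l)))).eval z) := by
  obtain ⟨G, M, hM, hrep, hI2⟩ := exists_outer_rep z h j k l m
  rw [hI2]
  congr 1
  have hdeg : ((X : ℝ[X]) ^ k * (1 - X) ^ l).natDegree ≤ d := by
    have := natDegree_vz_numerator_le z k l 0
    rw [pow_zero, mul_one, add_zero] at this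
    exact this.trans hd
  have key := hasseDeriv_eval_eq_of_eval_div_eq hM (by omega : 1 ≤ d + 1)
    (G₂ := C (-(z⁻¹) ^ (j + k - m)) * ((X : ℝ[X]) ^ j * (1 - X) ^ h *
      etaModel (d + 1 - (j + k - m)) (j + k - m) z (pullback d z (X ^ k * (1 - X) ^ l)))) fun x hxz => by
    rw [← hrep x hxz, innerRes_eq_res₁ hm, res₁_eq_resXZ hxz hz hdeg hnd, resXZ_eq_etaModel_div _ _ _ hxz,
      show d + 1 - (j + k - m) + (j + k - m) = d + 1 by omega]
    simp only [eval_mul, eval_C, eval_pow, eval_sub, eval_one, eval_X]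
    ring
  rw [key, Nat.add_sub_cancel, ← smul_eq_C_mul, LinearMap.map_smul, eval_smul, smul_eq_mul]

/-- `D^{(i)}(P(1−X)) = (−1)^i (D^{(i)}P)(1−X)`. [folklore] -/
theorem hasseDeriv_comp_one_sub_X (i : ℕ) (P : ℝ[X]) :
    hasseDeriv i (P.comp (1 - X)) = (-1) ^ i * (hasseDeriv i P).comp (1 - X) := by
  have h1 := congrFun (factorial_smul_hasseDeriv (R := ℝ) (k := i)) (P.comp (1 - X))
  have h2 := congrFun (factorial_smul_hasseDeriv (R := ℝ) (k := i)) P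
  simp only [LinearMap.smul_apply] at h1 h2
  rw [iterate_derivative_comp_one_sub_X, ← h2] at h1
  apply smul_right_injective ℝ[X] (Nat.factorial_ne_zero i)
  simp only
  rw [h1, smul_comp, mul_smul_comm]

/-- Evaluation of a reflected polynomial. [folklore] -/
theorem eval_comp_one_sub_X (P : ℝ[X]) (Z : ℝ) : (P.comp (1 - X)).eval Z = P.eval (1 - Z) := by
  rw [eval_comp, eval_sub, eval_one, eval_X]

/-- `(X^a(1−X)^b)(1−X) = (1−X)^a X^b`. [folklore] -/
theorem X_pow_mul_one_sub_pow_comp (a b : ℕ) :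
    ((X : ℝ[X]) ^ a * (1 - X) ^ b).comp (1 - X) = X ^ b * (1 - X) ^ a := by
  rw [mul_comp, pow_comp, pow_comp, X_comp, sub_comp, one_comp, X_comp, sub_sub_cancel, mul_comm]

end RhinViola

namespace ViolaZudilin

open RhinViola (I2 etaModel pullback resXZ res₁ etaModel_sum etaModel_smul pullback_sum pullback_vz_numerator
  numerator_eq_sum_latter hasseDeriv_mul_etaModel_eval I2_eq_eta hasseDeriv_comp_one_sub_X eval_comp_one_sub_X
  X_pow_mul_one_sub_pow_comp)

/-- **`J_z^{(2)}` in the `(ξ,η)` coordinates** (VZ (2.12) by Cauchy's formula twice: in `η` at `η = ξ`, then in `ξ`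
at `ξ = Z`): with `n = j+k−m`, `N = j+q−m`, `d = k+l+N`,
`J₂eta Z h j k l m q = (−1)^{l+N+1} Σ_{i≤n} (−1)^{n−i} binom(d−i, n−i) D^{(d−i)}[X^j(1−X)^h · D^{(i)}(X^k(1−X)^N)](Z)`,
a polynomial in `Z`. [cite: ViolaZudilin2018, (2.12)] -/
def J₂eta (Z : ℝ) (h j k l m q : ℕ) : ℝ :=
  (-1) ^ (l + (j + q - m) + 1) * ∑ i ∈ range (j + k - m + 1),
    ((-1) ^ (j + k - m - i) * ((k + l + (j + q - m) - i).choose (j + k - m - i) : ℝ)) *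
      (hasseDeriv (k + l + (j + q - m) - i)
        ((X : ℝ[X]) ^ j * (1 - X) ^ h * hasseDeriv i ((X : ℝ[X]) ^ k * (1 - X) ^ (j + q - m)))).eval Z

/-- The second representation of `J₂` summed in the `(ξ,η)` model. [cite: ViolaZudilin2018, (2.12)] -/
theorem sum_I2_eq_eta {z : ℝ} (hz : z ≠ 0) {j k m q : ℕ} (hm : m ≤ j + k) (hq : m ≤ j + q) (h l : ℕ) :
    ∑ lam ∈ range (j + q - m + 1), ((j + q - m).choose lam : ℝ) * z ^ ((k : ℤ) + m - q + lam) * (z - 1) ^ lam *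
        I2 z h j (k + lam) l (m + lam) =
      z ^ ((k : ℤ) - l - q) * (-(z⁻¹) ^ (j + k - m)) *
        (hasseDeriv (k + l + (j + q - m)) ((X : ℝ[X]) ^ j * (1 - X) ^ h *
          etaModel (k + l + (j + q - m) + 1 - (j + k - m)) (j + k - m) z
            (pullback (k + l + (j + q - m)) z ((X : ℝ[X]) ^ k * (1 - X) ^ l * (1 - X + C z * X) ^ (j + q - m))))).eval z := by
  set N := j + q - m with hN
  set n := j + k - m with hn
  set d := k + l + N with hd
  -- each `I2` in the `η` model, with the common `d`
  have hterm : ∀ lam ∈ range (N + 1), ((N.choose lam : ℝ) * z ^ ((k : ℤ) + m - q + lam) * (z - 1) ^ lam *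
      I2 z h j (k + lam) l (m + lam)) =
      (z ^ ((k : ℤ) - l - q) * (-(z⁻¹) ^ n)) * (((N.choose lam : ℝ) * (z - 1) ^ lam) *
        (hasseDeriv d ((X : ℝ[X]) ^ j * (1 - X) ^ h *
          etaModel (d + 1 - n) n z (pullback d z ((X : ℝ[X]) ^ (k + lam) * (1 - X) ^ l)))).eval z) := by
    intro lam hlam
    have hle : lam ≤ N := Nat.lt_succ_iff.1 (mem_range.1 hlam)
    rw [I2_eq_eta hz (by omega : m + lam ≤ j + (k + lam)) h l (d := d) (by omega) (by omega),
      show j + (k + lam) - (m + lam) = n by omega]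
    have hzz : z ^ ((k : ℤ) + m - q + lam) * z ^ (-((l : ℤ) + ((m + lam : ℕ) : ℤ))) = z ^ ((k : ℤ) - l - q) := by
      rw [← zpow_add₀ hz]; congr 1; simp only [Nat.cast_add]; ring
    calc ((N.choose lam : ℝ) * z ^ ((k : ℤ) + m - q + lam) * (z - 1) ^ lam *
          (z ^ (-((l : ℤ) + ((m + lam : ℕ) : ℤ))) * (-(z⁻¹) ^ n * (hasseDeriv d ((X : ℝ[X]) ^ j * (1 - X) ^ h *
            etaModel (d + 1 - n) n z (pullback d z (X ^ (k + lam) * (1 - X) ^ l)))).eval z)))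
        = (z ^ ((k : ℤ) + m - q + lam) * z ^ (-((l : ℤ) + ((m + lam : ℕ) : ℤ)))) * (-(z⁻¹) ^ n) *
            (((N.choose lam : ℝ) * (z - 1) ^ lam) * (hasseDeriv d ((X : ℝ[X]) ^ j * (1 - X) ^ h *
              etaModel (d + 1 - n) n z (pullback d z (X ^ (k + lam) * (1 - X) ^ l)))).eval z) := by ring
      _ = _ := by rw [hzz]
  rw [sum_congr rfl hterm, ← mul_sum]
  congr 1
  -- linearity: `Σ_λ c_λ · D^{(d)}[F·etaModel(pullback g_λ)](z) = D^{(d)}[F·etaModel(pullback (Σ c_λ g_λ))](z)`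
  rw [numerator_eq_sum_latter z k l N, pullback_sum, etaModel_sum, mul_sum, map_sum, eval_finsetSum]
  refine sum_congr rfl fun lam _ => ?_
  rw [mul_smul_comm, LinearMap.map_smul, eval_smul, smul_eq_mul]

/-- **`J₂ = J₂eta`** for real `z ≠ 0` (`m ≤ j+k`, `m ≤ j+q`). [cite: ViolaZudilin2018, (2.12)] -/
theorem J₂_eq_J₂eta {z : ℝ} (hz : z ≠ 0) {j k m q : ℕ} (hm : m ≤ j + k) (hq : m ≤ j + q) (h l : ℕ) :
    J₂ z h j k l m q = J₂eta z h j k l m q := by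
  rw [J₂_eq_sum_latter hz hm, sum_I2_eq_eta hz hm hq, pullback_vz_numerator, ← smul_eq_C_mul, etaModel_smul,
    mul_smul_comm, LinearMap.map_smul, eval_smul, smul_eq_mul, J₂eta]
  have hs : 1 ≤ k + l + (j + q - m) + 1 - (j + k - m) := by omega
  have hmain := hasseDeriv_mul_etaModel_eval hs (j + k - m) z ((X : ℝ[X]) ^ j * (1 - X) ^ h)
    ((X : ℝ[X]) ^ k * (1 - X) ^ (j + q - m))
  rw [show k + l + (j + q - m) + 1 - (j + k - m) + (j + k - m) - 1 = k + l + (j + q - m) by omega] at hmain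
  rw [hmain]
  have hpow : z ^ ((k : ℤ) - l - q) * (-(z⁻¹) ^ (j + k - m)) * ((-1) ^ (l + (j + q - m)) * z ^ (l + (j + q - m))) =
      (-1) ^ (l + (j + q - m) + 1) := by
    have h1 : z ^ ((k : ℤ) - l - q) * ((z⁻¹) ^ (j + k - m) * z ^ (l + (j + q - m))) = 1 := by
      rw [← zpow_natCast, ← zpow_natCast, inv_zpow', ← zpow_add₀ hz, ← zpow_add₀ hz, Nat.cast_sub hm,
        Nat.cast_add, Nat.cast_add, Nat.cast_sub hq]
      push_cast
      ring_nf
      exact zpow_zero z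
    rw [pow_succ]
    linear_combination (-(-1) ^ (l + (j + q - m))) * h1
  have hsum : ∑ i ∈ range (j + k - m + 1),
      (-1) ^ (j + k - m - i) * (((k + l + (j + q - m) + 1 - (j + k - m) + (j + k - m - i) - 1).choose (j + k - m - i) : ℕ) : ℝ) *
        (hasseDeriv (k + l + (j + q - m) - i)
          ((X : ℝ[X]) ^ j * (1 - X) ^ h * hasseDeriv i ((X : ℝ[X]) ^ k * (1 - X) ^ (j + q - m)))).eval z =
      ∑ i ∈ range (j + k - m + 1),
      (-1) ^ (j + k - m - i) * (((k + l + (j + q - m) - i).choose (j + k - m - i) : ℕ) : ℝ) *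
        (hasseDeriv (k + l + (j + q - m) - i)
          ((X : ℝ[X]) ^ j * (1 - X) ^ h * hasseDeriv i ((X : ℝ[X]) ^ k * (1 - X) ^ (j + q - m)))).eval z := by
    refine sum_congr rfl fun i hi => ?_
    have hin : i ≤ j + k - m := Nat.lt_succ_iff.1 (mem_range.1 hi)
    rw [show k + l + (j + q - m) + 1 - (j + k - m) + (j + k - m - i) - 1 = k + l + (j + q - m) - i by omega]
  rw [hsum, ← hpow]
  ring

/-! ### Lemma 2.3 -/

/-- The reflected bracket: `D^{(r)}[X^h(1−X)^j · D^{(i)}(X^N(1−X)^k)](Z) = (−1)^{r+i} D^{(r)}[X^j(1−X)^h · D^{(i)}(X^k(1−X)^N)](1−Z)`.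
[cite: ViolaZudilin2018, (2.13)] -/
theorem hasseDeriv_bracket_reflect (r i h j k N : ℕ) (Z : ℝ) :
    (hasseDeriv r ((X : ℝ[X]) ^ h * (1 - X) ^ j * hasseDeriv i ((X : ℝ[X]) ^ N * (1 - X) ^ k))).eval Z =
      (-1) ^ (r + i) * (hasseDeriv r ((X : ℝ[X]) ^ j * (1 - X) ^ h * hasseDeriv i ((X : ℝ[X]) ^ k * (1 - X) ^ N))).eval (1 - Z) := by
  have h1 : (X : ℝ[X]) ^ h * (1 - X) ^ j * hasseDeriv i ((X : ℝ[X]) ^ N * (1 - X) ^ k) =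
      ((-1 : ℝ) ^ i) • (((X : ℝ[X]) ^ j * (1 - X) ^ h * hasseDeriv i ((X : ℝ[X]) ^ k * (1 - X) ^ N)).comp (1 - X)) := by
    rw [← X_pow_mul_one_sub_pow_comp j h, ← X_pow_mul_one_sub_pow_comp k N, hasseDeriv_comp_one_sub_X]
    simp only [mul_comp, smul_eq_C_mul, map_pow, map_neg, map_one]
    ring
  rw [h1, LinearMap.map_smul, hasseDeriv_comp_one_sub_X, eval_smul, eval_mul, eval_pow, eval_neg, eval_one,
    eval_comp_one_sub_X, smul_eq_mul, pow_add]
  ring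

/-- **Viola–Zudilin Lemma 2.3** (for the Hasse form `J₂eta`, all real `Z`): with `k ≤ h+q`, `m ≤ j+k`, `m ≤ j+q`,
`J^{(2)}_{1−Z}(j, h, j+q−m, l, h+q−k, q) = (−1)^l J^{(2)}_Z(h, j, k, l, m, q)`. [cite: ViolaZudilin2018, Lemma 2.3] -/
theorem J₂eta_reflect (Z : ℝ) {h j k m q : ℕ} (hk : k ≤ h + q) (hm : m ≤ j + k) (hq : m ≤ j + q) (l : ℕ) :
    J₂eta (1 - Z) j h (j + q - m) l (h + q - k) q = (-1) ^ l * J₂eta Z h j k l m q := by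
  have e1 : h + (j + q - m) - (h + q - k) = j + k - m := by omega
  have e2 : h + q - (h + q - k) = k := by omega
  have e3 : j + q - m + l + k = k + l + (j + q - m) := by omega
  unfold J₂eta
  simp only [e1, e2, e3]
  rw [mul_sum, mul_sum, mul_sum]
  refine sum_congr rfl fun i hi => ?_
  have hin : i ≤ j + k - m := Nat.lt_succ_iff.1 (mem_range.1 hi)
  rw [hasseDeriv_bracket_reflect, sub_sub_cancel,
    show k + l + (j + q - m) - i + i = k + l + (j + q - m) by omega, pow_add, pow_add, pow_add, pow_add, pow_add,
    pow_add]
  rcases neg_one_pow_eq_or ℝ k with h1 | h1 <;> rw [h1] <;> ring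

end ViolaZudilin

end Literature.NumberTheory.DiophantineApproximation

end
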